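import Literature.RingTheory.Valuation.IntegralPointOfPrescribedSpecialisation
import Literature.AlgebraicGeometry.Morphisms.AffinePointsOverSpec
import Mathlib.AlgebraicGeometry.Morphisms.Finite
import Mathlib.AlgebraicGeometry.Morphisms.Flat
import Mathlib.CategoryTheory.Monoidal.Cartesian.Over
import HarnessLib

/-!
# A finite flat scheme over the valuation ring of an algebraically closed field: every point of the special fibre is the reduction of a
# section ([SerreTate1968] §1 Lemma 1, finite-level mechanism; [StacksProject] Tag 04GG)

Topic `Literature/AlgebraicGeometry/Morphisms`, namespace `Literature.AlgebraicGeometry.Morphisms`.  THEOREMS ONLY (no definition, no named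
fact, no instance, no notation, no `sorry`).  SCHEME SHELL of ★ `Valuation/IntegralPointOfPrescribedSpecialisation.exists_algHom_residue_comp_eq`
(the algebra: a `κ(V)`-point of a finite flat `V`-algebra is the specialisation of a `V`-point), through the points dictionary ★
`Morphisms/AffinePointsOverSpec` ([StacksProject] Tag 01I1): for `V ⊆ Ω` the valuation ring of an ALGEBRAICALLY CLOSED field and `G → Spec V`
FINITE and FLAT (an object of `Over (Spec V)`), every `t₀ : Spec κ(V) → G` over `Spec V` is `Spec κ(V) → Spec V → G` for a SECTION
`s : 𝟙 ⟶ G` of `Over (Spec V)`.  Cell `pub/hodgecm-mathlib` (D-0151 ∕ D-0183 floor 0), P6 «MOD», sub-line P6b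
`Cruxes/HLiu418/Lines/F0_P6b_ConnectedEtale.lean` ED. 1: this IS the text of `stub_b1d_reductionSurjective` (M-1a (b1-iii), surjectivity half of
«`G(Ω) = G(V) → G(κ̄)` is surjective with kernel `G⁰`»), stated generically; generic capital `--supports stmt-HodgeConjecture-24832`.  HONEST LABEL:
HC_CM is proved only modulo the cell's 2 remaining named inputs (hLiu418 24832, h413 24833) until rung 0 closes; this file pays no letter.

* `finite_flat_structureRingHom` — for `G → Spec V` finite and flat (`G` is then affine), `Γ(G, 𝒪)` is module-finite and flat over `V` through
  the structure map `V ≅ Γ(Spec V) → Γ(G)` (Mathlib `Scheme.Hom.finite_appTop`, `HasRingHomProperty.iff_of_isAffine` for `Flat`);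
* **`exists_section_residue_comp_eq`** — the head: `∃ s : 𝟙_ ⟶ G, Spec (residue V) ≫ s.left = t₀`.  FALSE without flatness
  (`G = Spec κ(V)`) and FALSE over a DVR with algebraically closed residue field but non-closed fraction field (the line card's witness:
  ordinary `E[p]` over `W(κ̄)`), whence `V ⊆ Ω = Ω̄`.

## References
* [SerreTate1968] J.-P. Serre, J. Tate, *Good reduction of abelian varieties*, Ann. of Math. 88 (1968), §1 Lemma 1 (reduction map on points of
  finite flat group schemes over a strictly henselian base).
* [StacksProject] The Stacks Project, Tag 04GG (11) (finite over henselian local: product of local rings), Tag 01I1 (points of an affine scheme),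
  Tag 00NZ (finite flat over local is free).
-/

set_option autoImplicit false

noncomputable section

universe u

open CategoryTheory AlgebraicGeometry IsLocalRing MonoidalCategory

namespace Literature.AlgebraicGeometry.Morphisms

/-- **`Γ(G, 𝒪)` is module-finite and flat over `V`** through the structure map `φ = (ΓSpecIso V)⁻¹ ≫ Γ(G → Spec V)`, for `G → Spec V` finite
and flat with `G` affine. [cite: StacksProject, Tag 01I1] -/
theorem finite_flat_structureRingHom {V : CommRingCat.{u}} (G : Over (Spec V)) [IsAffine G.left] [IsFinite G.hom] [Flat G.hom] :
    ((Scheme.ΓSpecIso V).inv ≫ G.hom.appTop).hom.Finite ∧ ((Scheme.ΓSpecIso V).inv ≫ G.hom.appTop).hom.Flat := by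
  have hbij : Function.Bijective (Scheme.ΓSpecIso V).inv.hom := ConcreteCategory.bijective_of_isIso (Scheme.ΓSpecIso V).inv
  refine ⟨?_, ?_⟩
  · rw [CommRingCat.hom_comp]
    exact RingHom.Finite.comp (Scheme.Hom.finite_appTop G.hom) (RingHom.Finite.of_surjective _ hbij.2)
  · rw [CommRingCat.hom_comp]
    exact RingHom.Flat.comp (RingHom.Flat.of_bijective hbij)
      ((HasRingHomProperty.iff_of_isAffine (P := @Flat)).mp inferInstance)

/-- **Every point of the special fibre of a finite flat scheme over the valuation ring of an algebraically closed field is the reduction of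
a section.**  `V ⊆ Ω` the valuation ring of an algebraically closed field, `G → Spec V` finite and flat, `t₀ : Spec κ(V) → G` over `Spec V`
⟹ `∃ s : 𝟙_ (Over (Spec V)) ⟶ G` with `Spec (residue V) ≫ s.left = t₀`.  Proof: `G` is affine; its coordinate ring is finite flat over
`V`; `t₀` is a ring map `χ : Γ(G, 𝒪) → κ(V)` under `V` (★ `comp_eq_specMap_iff`), which is the specialisation of a `V`-point `ψ` (★
`ValuationSubring.exists_algHom_residue_comp_eq`); `s := Spec ψ ≫ isoSpec⁻¹` (★ `appTop_specMap_comp_isoSpec_inv_comp_ΓSpecIso_hom`,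
injectivity of ★ `bijective_appTop_comp_ΓSpecIso_hom`). [cite: SerreTate1968, §1 Lemma 1] [cite: StacksProject, Tag 04GG] -/
theorem exists_section_residue_comp_eq {Ω : Type} [Field Ω] [IsAlgClosed Ω] (V : ValuationSubring Ω)
    (G : Over (Spec (CommRingCat.of V))) [IsFinite G.hom] [Flat G.hom]
    (t₀ : Spec (CommRingCat.of (ResidueField V)) ⟶ G.left)
    (ht₀ : t₀ ≫ G.hom = Spec.map (CommRingCat.ofHom (residue V))) :
    ∃ s : 𝟙_ (Over (Spec (CommRingCat.of V))) ⟶ G, Spec.map (CommRingCat.ofHom (residue V)) ≫ s.left = t₀ := by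
  haveI : IsAffine G.left := isAffine_of_isAffineHom G.hom
  -- the coordinate ring as a `V`-algebra
  set φ : CommRingCat.of (↥V) ⟶ Γ(G.left, ⊤) := (Scheme.ΓSpecIso (.of ↥V)).inv ≫ G.hom.appTop with hφ
  letI : Algebra (↥V) Γ(G.left, ⊤) := φ.hom.toAlgebra
  obtain ⟨hfin, hflat⟩ := finite_flat_structureRingHom G
  haveI : Module.Finite (↥V) Γ(G.left, ⊤) := hfin
  haveI : Module.Flat (↥V) Γ(G.left, ⊤) := hflat
  -- the point as a ring map under `V`
  set χ : Γ(G.left, ⊤) →+* ResidueField ↥V := (t₀.appTop ≫ (Scheme.ΓSpecIso (.of (ResidueField ↥V))).hom).hom with hχdef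
  have hχ : χ.comp (algebraMap (↥V) Γ(G.left, ⊤)) = residue ↥V := by
    have h := (comp_eq_specMap_iff G.hom (CommRingCat.ofHom (residue ↥V)) t₀).mp ht₀
    have h' := congrArg CommRingCat.Hom.hom h
    simp only [CommRingCat.hom_comp, CommRingCat.hom_ofHom] at h'
    rw [RingHom.algebraMap_toAlgebra, hχdef, hφ, CommRingCat.hom_comp, CommRingCat.hom_comp]
    exact h'
  obtain ⟨ψ, hψ⟩ := ValuationSubring.exists_algHom_residue_comp_eq V χ hχ
  -- the section
  let s₀ : Spec (CommRingCat.of ↥V) ⟶ G.left := Spec.map (CommRingCat.ofHom ψ.toRingHom) ≫ G.left.isoSpec.inv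
  have hs₀chart : s₀.appTop ≫ (Scheme.ΓSpecIso (.of ↥V)).hom = CommRingCat.ofHom ψ.toRingHom :=
    appTop_specMap_comp_isoSpec_inv_comp_ΓSpecIso_hom _
  have hs₀ : s₀ ≫ G.hom = 𝟙 (Spec (CommRingCat.of ↥V)) := by
    rw [← Spec.map_id]
    refine (comp_eq_specMap_iff G.hom (𝟙 (CommRingCat.of ↥V)) s₀).mpr ?_
    rw [hs₀chart]
    apply CommRingCat.hom_ext
    exact RingHom.ext fun r => ψ.commutes r
  refine ⟨Over.homMk s₀ hs₀, ?_⟩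
  change Spec.map (CommRingCat.ofHom (residue ↥V)) ≫ s₀ = t₀
  apply bijective_appTop_comp_ΓSpecIso_hom.1
  change (Spec.map (CommRingCat.ofHom (residue ↥V)) ≫ s₀).appTop ≫ _ = t₀.appTop ≫ _
  rw [show Spec.map (CommRingCat.ofHom (residue ↥V)) ≫ s₀ =
      Spec.map (CommRingCat.ofHom ψ.toRingHom ≫ CommRingCat.ofHom (residue ↥V)) ≫ G.left.isoSpec.inv by
    rw [Spec.map_comp, Category.assoc],
    appTop_specMap_comp_isoSpec_inv_comp_ΓSpecIso_hom]
  ext b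
  change (residue ↥V) (ψ.toRingHom b) = χ b
  exact RingHom.congr_fun hψ b

end Literature.AlgebraicGeometry.Morphisms

end
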